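import Summits.AtomisticToContinuum.Crystallization.Theses.HolmgrenBoyleLind
import Literature.Probability.Process.PointStationaryLaw

/-!
# Crux `HolmgrenBoyleLind.GroundStatesChargeFLCEquilibrium` (stmt-AtomisticToContinuum-6076):
# the Palm law of the two-point cluster (test laws for the content stub)

Tools for the tightness analysis of the registered content stub `stub_minimisingLawsChargeFLC`
(every minimising point-stationary hard-core law charges an FLC Delone set), used by the companion
file `…StubTightnessCarrier`:

* Dirac laws at FINITELY CARRIED configurations in the Giry σ-algebra: if `μ₀ Sᶜ = 0` for a
  finite `S ⊂ ℝ³` then `{μ | μ = μ₀}` is measurable (`measurableSet_setOf_eq_of_measure_compl_finite`: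
  it is cut out by `μ Sᶜ = 0` and the evaluations `μ {a} = μ₀ {a}`, `a ∈ S`), so under `δ_{μ₀}`
  almost every configuration is `μ₀` and integrals against `δ_{μ₀}` are evaluations, with no
  measurability of the integrand (`ae_eq_dirac_of_measure_compl_finite`,
  `lintegral_dirac_of_measure_compl_finite`, `integral_dirac_of_measure_compl_finite`,
  `integrable_dirac_of_measure_compl_finite`).
* The WEIGHTED TWO-POINT rooted configuration `w δ_0 + w δ_u` (`w : ℝ≥0∞`): carrier, integrals,
  shifts, root energy `w (V_LJ 0 + V_LJ 1) = -w/12` at `‖u‖ = 1` (`twoPoint_measure_compl`,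
  `twoPoint_measure_compl_eq_zero`, `lintegral_twoPoint`, `integral_twoPoint`, `map_sub_twoPoint`,
  `rootEnergy_twoPoint`), and for unit weight the identification with the rooted `1`-hard-core
  counting measure `count|{0, u}` (`twoPoint_one_eq_count_restrict`,
  `isRootedHardCore_twoPoint_one`).
* The PALM LAW OF THE TWO-POINT CLUSTER `{0, v}` with atom weight `w`,
  `P_w = ½ (δ_{w δ_0 + w δ_v} + δ_{w δ_0 + w δ_{-v}})` (root the cluster at either point): it is
  point-stationary for every `w` and `v` (`isPointStationaryLaw_twoPointPalm` — the Mecke /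
  mass-transport identity holds because the shift by `v` carries `w δ_0 + w δ_v` to
  `w δ_0 + w δ_{-v}` and the shift by `-v` carries it back), a probability law
  (`isProbabilityMeasure_twoPointPalm`), the mean of a functional is the average of its two values
  (`integral_twoPointPalm`), and it is carried by configurations inside `B̄(0, ‖v‖)`
  (`ae_twoPointPalm_measure_compl_closedBall`).

All `[folklore]` (Palm law of a finite cluster = uniform re-rooting, [LastPenrose2017, Ch. 9]);
helper file for item stmt-AtomisticToContinuum-6076 (`--supports`); nothing here closes an item.
-/

noncomputable section

open MeasureTheory Filter Set
open scoped ENNReal Topology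

namespace Summit.AtomisticToContinuum.Crystallization.Theorems.HolmgrenBoyleLindGroundStatesChargeFLCEquilibrium

open Literature.MathematicalPhysics.StatisticalMechanics Literature.Probability.Process


/-! ### Dirac laws at finitely carried configurations -/

/-- In the Giry σ-algebra the singleton of a configuration `μ₀` carried by a FINITE set `S`
(`μ₀ Sᶜ = 0`) is measurable: `{μ | μ = μ₀}` is cut out by `μ Sᶜ = 0` and the finitely many
evaluations `μ {a} = μ₀ {a}`, `a ∈ S`. [folklore] -/
theorem measurableSet_setOf_eq_of_measure_compl_finite {S : Set (EuclideanSpace ℝ (Fin 3))}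
    (hS : S.Finite) {μ₀ : Measure (EuclideanSpace ℝ (Fin 3))} (h0 : μ₀ Sᶜ = 0) :
    MeasurableSet {μ : Measure (EuclideanSpace ℝ (Fin 3)) | μ = μ₀} := by
  have hSm : MeasurableSet S := hS.measurableSet
  have hrepr : {μ : Measure (EuclideanSpace ℝ (Fin 3)) | μ = μ₀} =
      {μ : Measure (EuclideanSpace ℝ (Fin 3)) | μ Sᶜ = 0} ∩
        ⋂ a ∈ S, {μ : Measure (EuclideanSpace ℝ (Fin 3)) | μ {a} = μ₀ {a}} := by
    ext μ
    simp only [mem_setOf_eq, mem_inter_iff, mem_iInter]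
    constructor
    · rintro rfl
      exact ⟨h0, fun a _ => rfl⟩
    · rintro ⟨hc, h1⟩
      ext s hs
      have hfin : (s ∩ S).Finite := hS.inter_of_right s
      have hU : s ∩ S = ⋃ b ∈ hfin.toFinset, {b} := by
        ext
        simp
      have hdisj : (↑hfin.toFinset : Set (EuclideanSpace ℝ (Fin 3))).PairwiseDisjoint
          (fun b : EuclideanSpace ℝ (Fin 3) => ({b} : Set (EuclideanSpace ℝ (Fin 3)))) :=
        fun a _ b _ hab => disjoint_singleton.2 hab
      have hsum : ∀ ν : Measure (EuclideanSpace ℝ (Fin 3)), ν Sᶜ = 0 →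
          ν s = ∑ b ∈ hfin.toFinset, ν {b} := by
        intro ν hν
        have h1 : ν s = ν (s ∩ S) := by
          rw [← measure_inter_add_sdiff s hSm, measure_mono_null (sdiff_subset_compl s S) hν,
            add_zero]
        have h2 : ν (⋃ b ∈ hfin.toFinset, {b}) = ∑ b ∈ hfin.toFinset, ν {b} :=
          measure_biUnion_finset hdisj (fun b _ => measurableSet_singleton b)
        rw [h1, ← h2, ← hU]
      rw [hsum μ hc, hsum μ₀ h0]
      exact Finset.sum_congr rfl fun b hb => h1 b (hfin.mem_toFinset.1 hb).2
  rw [hrepr]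
  refine ((Measure.measurable_coe hSm.compl) (measurableSet_singleton 0)).inter ?_
  exact MeasurableSet.biInter hS.countable fun a _ =>
    (Measure.measurable_coe (measurableSet_singleton a)) (measurableSet_singleton _)

/-- Under the Dirac law at a finitely carried configuration `μ₀`, almost every configuration IS
`μ₀`. [folklore] -/
theorem ae_eq_dirac_of_measure_compl_finite {S : Set (EuclideanSpace ℝ (Fin 3))} (hS : S.Finite)
    {μ₀ : Measure (EuclideanSpace ℝ (Fin 3))} (h0 : μ₀ Sᶜ = 0) :
    ∀ᵐ μ ∂(Measure.dirac μ₀ : Measure (Measure (EuclideanSpace ℝ (Fin 3)))), μ = μ₀ :=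
  (ae_dirac_iff (measurableSet_setOf_eq_of_measure_compl_finite hS h0)).2 rfl

/-- Lower integral against the Dirac law at a finitely carried configuration: evaluation (no
measurability of the integrand is needed). [folklore] -/
theorem lintegral_dirac_of_measure_compl_finite {S : Set (EuclideanSpace ℝ (Fin 3))}
    (hS : S.Finite) {μ₀ : Measure (EuclideanSpace ℝ (Fin 3))} (h0 : μ₀ Sᶜ = 0)
    (F : Measure (EuclideanSpace ℝ (Fin 3)) → ℝ≥0∞) :
    ∫⁻ μ, F μ ∂(Measure.dirac μ₀ : Measure (Measure (EuclideanSpace ℝ (Fin 3)))) = F μ₀ := by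
  have hae : F =ᵐ[(Measure.dirac μ₀ : Measure (Measure (EuclideanSpace ℝ (Fin 3))))]
      fun _ => F μ₀ :=
    (ae_eq_dirac_of_measure_compl_finite hS h0).mono fun μ hμ => by
      show F μ = F μ₀
      rw [hμ]
  rw [lintegral_congr_ae hae, lintegral_const, measure_univ, mul_one]

/-- Bochner integral against the Dirac law at a finitely carried configuration: evaluation.
[folklore] -/
theorem integral_dirac_of_measure_compl_finite {S : Set (EuclideanSpace ℝ (Fin 3))}
    (hS : S.Finite) {μ₀ : Measure (EuclideanSpace ℝ (Fin 3))} (h0 : μ₀ Sᶜ = 0)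
    (f : Measure (EuclideanSpace ℝ (Fin 3)) → ℝ) :
    ∫ μ, f μ ∂(Measure.dirac μ₀ : Measure (Measure (EuclideanSpace ℝ (Fin 3)))) = f μ₀ := by
  have hae : f =ᵐ[(Measure.dirac μ₀ : Measure (Measure (EuclideanSpace ℝ (Fin 3))))]
      fun _ => f μ₀ :=
    (ae_eq_dirac_of_measure_compl_finite hS h0).mono fun μ hμ => by
      show f μ = f μ₀
      rw [hμ]
  rw [integral_congr_ae hae, integral_const]
  simp only [probReal_univ, smul_eq_mul, one_mul]

/-- Every real function is integrable against the Dirac law at a finitely carried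
configuration (it is a.e. constant). [folklore] -/
theorem integrable_dirac_of_measure_compl_finite {S : Set (EuclideanSpace ℝ (Fin 3))}
    (hS : S.Finite) {μ₀ : Measure (EuclideanSpace ℝ (Fin 3))} (h0 : μ₀ Sᶜ = 0)
    (f : Measure (EuclideanSpace ℝ (Fin 3)) → ℝ) :
    Integrable f (Measure.dirac μ₀ : Measure (Measure (EuclideanSpace ℝ (Fin 3)))) := by
  refine (integrable_const (f μ₀)).congr ?_
  exact (ae_eq_dirac_of_measure_compl_finite hS h0).mono fun μ hμ => by
    show f μ₀ = f μ
    rw [hμ]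

/-! ### The weighted two-point rooted configuration `w δ_0 + w δ_u` -/

/-- The weighted two-point configuration is carried by `{0, u}`. [folklore] -/
theorem twoPoint_measure_compl (w : ℝ≥0∞) (u : EuclideanSpace ℝ (Fin 3)) :
    (w • Measure.dirac (0 : EuclideanSpace ℝ (Fin 3)) + w • Measure.dirac u)
      ({0, u} : Set (EuclideanSpace ℝ (Fin 3)))ᶜ = 0 := by
  have h0 : (0 : EuclideanSpace ℝ (Fin 3)) ∉ ({0, u} : Set (EuclideanSpace ℝ (Fin 3)))ᶜ :=
    fun h => h (by simp)
  have hu : u ∉ ({0, u} : Set (EuclideanSpace ℝ (Fin 3)))ᶜ := fun h => h (by simp)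
  simp only [Measure.add_apply, Measure.smul_apply, Measure.dirac_apply, indicator_of_notMem h0,
    indicator_of_notMem hu, smul_eq_mul, mul_zero, add_zero]

/-- The weighted two-point configuration gives no mass to the complement of a set containing
both points. [folklore] -/
theorem twoPoint_measure_compl_eq_zero (w : ℝ≥0∞) {u : EuclideanSpace ℝ (Fin 3)}
    {B : Set (EuclideanSpace ℝ (Fin 3))} (h0 : (0 : EuclideanSpace ℝ (Fin 3)) ∈ B) (hu : u ∈ B) :
    (w • Measure.dirac (0 : EuclideanSpace ℝ (Fin 3)) + w • Measure.dirac u) Bᶜ = 0 := by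
  have h0' : (0 : EuclideanSpace ℝ (Fin 3)) ∉ Bᶜ := fun h => h h0
  have hu' : u ∉ Bᶜ := fun h => h hu
  simp only [Measure.add_apply, Measure.smul_apply, Measure.dirac_apply, indicator_of_notMem h0',
    indicator_of_notMem hu', smul_eq_mul, mul_zero, add_zero]

/-- Lower integral against the weighted two-point configuration. [folklore] -/
theorem lintegral_twoPoint (w : ℝ≥0∞) (u : EuclideanSpace ℝ (Fin 3))
    (G : EuclideanSpace ℝ (Fin 3) → ℝ≥0∞) :
    ∫⁻ y, G y ∂(w • Measure.dirac (0 : EuclideanSpace ℝ (Fin 3)) + w • Measure.dirac u) =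
      w * G 0 + w * G u := by
  rw [lintegral_add_measure, lintegral_smul_measure, lintegral_smul_measure, lintegral_dirac,
    lintegral_dirac, smul_eq_mul, smul_eq_mul]

/-- Bochner integral against the weighted two-point configuration (finite weight). [folklore] -/
theorem integral_twoPoint {w : ℝ≥0∞} (hw : w ≠ ∞) (u : EuclideanSpace ℝ (Fin 3))
    (f : EuclideanSpace ℝ (Fin 3) → ℝ) :
    ∫ y, f y ∂(w • Measure.dirac (0 : EuclideanSpace ℝ (Fin 3)) + w • Measure.dirac u) =
      w.toReal * f 0 + w.toReal * f u := by
  have hi : ∀ a : EuclideanSpace ℝ (Fin 3), Integrable f (w • Measure.dirac a) := fun a =>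
    ((integrable_const (f a)).congr (ae_eq_dirac f).symm).smul_measure hw
  rw [integral_add_measure (hi 0) (hi u), integral_smul_measure, integral_smul_measure,
    integral_dirac, integral_dirac, smul_eq_mul, smul_eq_mul]

/-- Re-rooting (shifting) the weighted two-point configuration. [folklore] -/
theorem map_sub_twoPoint (w : ℝ≥0∞) (u y : EuclideanSpace ℝ (Fin 3)) :
    Measure.map (fun z => z - y)
        (w • Measure.dirac (0 : EuclideanSpace ℝ (Fin 3)) + w • Measure.dirac u) =
      w • Measure.dirac (0 - y) + w • Measure.dirac (u - y) := by
  rw [Measure.map_add _ _ (measurable_sub_const y), Measure.map_smul, Measure.map_smul,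
    Measure.map_dirac' (measurable_sub_const y), Measure.map_dirac' (measurable_sub_const y)]

/-! ### The Palm law of the two-point cluster is point-stationary -/

/-- **The (unnormalised) Palm law of the weighted two-point cluster `{0, v}` is
point-stationary.** Rooting the cluster `w δ_0 + w δ_v` at either of its points gives the
configurations `w δ_0 + w δ_v` and `w δ_0 + w δ_{-v}`; the law `δ_{w δ_0 + w δ_v} + δ_{w δ_0 + w δ_{-v}}`
satisfies the Mecke / mass-transport identity: both sides equal
`w (g(μ₊, 0) + g(μ₊, v) + g(μ₋, 0) + g(μ₋, -v))`, because the shift by `v` carries `μ₊` to `μ₋`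
and the shift by `-v` carries `μ₋` back to `μ₊`. (Palm law of a finite cluster = uniform
re-rooting; here written out for two points and arbitrary atom weight.) [folklore] -/
theorem isPointStationaryLaw_twoPointPalm :
    ∀ (w : ENNReal) (v : EuclideanSpace ℝ (Fin 3)), Literature.Probability.Process.IsPointStationaryLaw
      ((Measure.dirac (w • Measure.dirac (0 : EuclideanSpace ℝ (Fin 3)) + w • Measure.dirac v) +
        Measure.dirac (w • Measure.dirac (0 : EuclideanSpace ℝ (Fin 3)) + w • Measure.dirac (-v))) :
        Measure (Measure (EuclideanSpace ℝ (Fin 3)))) := by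
  intro w v g _
  have hSp : ({0, v} : Set (EuclideanSpace ℝ (Fin 3))).Finite := (finite_singleton v).insert 0
  have hSm : ({0, -v} : Set (EuclideanSpace ℝ (Fin 3))).Finite := (finite_singleton (-v)).insert 0
  have hp0 := twoPoint_measure_compl w v
  have hm0 := twoPoint_measure_compl w (-v)
  rw [lintegral_add_measure, lintegral_add_measure,
    lintegral_dirac_of_measure_compl_finite hSp hp0, lintegral_dirac_of_measure_compl_finite hSm hm0,
    lintegral_dirac_of_measure_compl_finite hSp hp0, lintegral_dirac_of_measure_compl_finite hSm hm0,
    lintegral_twoPoint, lintegral_twoPoint, lintegral_twoPoint, lintegral_twoPoint]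
  -- the four shifts
  have h1 : Measure.map (fun z => z - (0 : EuclideanSpace ℝ (Fin 3)))
      (w • Measure.dirac (0 : EuclideanSpace ℝ (Fin 3)) + w • Measure.dirac v) =
      w • Measure.dirac (0 : EuclideanSpace ℝ (Fin 3)) + w • Measure.dirac v := by
    rw [map_sub_twoPoint, sub_zero, sub_zero]
  have h2 : Measure.map (fun z => z - v)
      (w • Measure.dirac (0 : EuclideanSpace ℝ (Fin 3)) + w • Measure.dirac v) =
      w • Measure.dirac (0 : EuclideanSpace ℝ (Fin 3)) + w • Measure.dirac (-v) := by
    rw [map_sub_twoPoint, zero_sub, sub_self, add_comm]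
  have h3 : Measure.map (fun z => z - (0 : EuclideanSpace ℝ (Fin 3)))
      (w • Measure.dirac (0 : EuclideanSpace ℝ (Fin 3)) + w • Measure.dirac (-v)) =
      w • Measure.dirac (0 : EuclideanSpace ℝ (Fin 3)) + w • Measure.dirac (-v) := by
    rw [map_sub_twoPoint, sub_zero, sub_zero]
  have h4 : Measure.map (fun z => z - (-v))
      (w • Measure.dirac (0 : EuclideanSpace ℝ (Fin 3)) + w • Measure.dirac (-v)) =
      w • Measure.dirac (0 : EuclideanSpace ℝ (Fin 3)) + w • Measure.dirac v := by
    rw [map_sub_twoPoint, zero_sub, neg_neg, sub_self, add_comm]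
  rw [h1, h2, h3, h4, neg_zero, neg_neg]
  ring

/-- **The normalised Palm law of the two-point cluster is a probability law.** [folklore] -/
theorem isProbabilityMeasure_twoPointPalm (w : ℝ≥0∞) (v : EuclideanSpace ℝ (Fin 3)) :
    IsProbabilityMeasure
      (((2 : ℝ≥0∞)⁻¹ •
        (Measure.dirac (w • Measure.dirac (0 : EuclideanSpace ℝ (Fin 3)) + w • Measure.dirac v) +
          Measure.dirac (w • Measure.dirac (0 : EuclideanSpace ℝ (Fin 3)) + w • Measure.dirac (-v)))) :
        Measure (Measure (EuclideanSpace ℝ (Fin 3)))) := by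
  refine ⟨?_⟩
  rw [Measure.smul_apply, Measure.add_apply, measure_univ, measure_univ, smul_eq_mul,
    one_add_one_eq_two]
  exact ENNReal.inv_mul_cancel two_ne_zero ENNReal.ofNat_ne_top

/-- **Mean of a real functional under the normalised two-point Palm law**: the average of its two
values. [folklore] -/
theorem integral_twoPointPalm (w : ℝ≥0∞) (v : EuclideanSpace ℝ (Fin 3))
    (f : Measure (EuclideanSpace ℝ (Fin 3)) → ℝ) :
    ∫ μ, f μ ∂(((2 : ℝ≥0∞)⁻¹ •
        (Measure.dirac (w • Measure.dirac (0 : EuclideanSpace ℝ (Fin 3)) + w • Measure.dirac v) +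
          Measure.dirac (w • Measure.dirac (0 : EuclideanSpace ℝ (Fin 3)) + w • Measure.dirac (-v)))) :
        Measure (Measure (EuclideanSpace ℝ (Fin 3)))) =
      2⁻¹ * (f (w • Measure.dirac (0 : EuclideanSpace ℝ (Fin 3)) + w • Measure.dirac v) +
        f (w • Measure.dirac (0 : EuclideanSpace ℝ (Fin 3)) + w • Measure.dirac (-v))) := by
  have hSp : ({0, v} : Set (EuclideanSpace ℝ (Fin 3))).Finite := (finite_singleton v).insert 0
  have hSm : ({0, -v} : Set (EuclideanSpace ℝ (Fin 3))).Finite := (finite_singleton (-v)).insert 0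
  have hp0 := twoPoint_measure_compl w v
  have hm0 := twoPoint_measure_compl w (-v)
  rw [integral_smul_measure, integral_add_measure (integrable_dirac_of_measure_compl_finite hSp hp0 f)
      (integrable_dirac_of_measure_compl_finite hSm hm0 f),
    integral_dirac_of_measure_compl_finite hSp hp0, integral_dirac_of_measure_compl_finite hSm hm0,
    smul_eq_mul, ENNReal.toReal_inv, ENNReal.toReal_ofNat]

/-- **The two-point Palm law is carried by configurations inside the closed ball of radius
`‖v‖`.** [folklore] -/
theorem ae_twoPointPalm_measure_compl_closedBall (w : ℝ≥0∞) (v : EuclideanSpace ℝ (Fin 3)) :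
    ∀ᵐ ν ∂(((2 : ℝ≥0∞)⁻¹ •
        (Measure.dirac (w • Measure.dirac (0 : EuclideanSpace ℝ (Fin 3)) + w • Measure.dirac v) +
          Measure.dirac (w • Measure.dirac (0 : EuclideanSpace ℝ (Fin 3)) + w • Measure.dirac (-v)))) :
        Measure (Measure (EuclideanSpace ℝ (Fin 3)))),
      ν (Metric.closedBall (0 : EuclideanSpace ℝ (Fin 3)) ‖v‖)ᶜ = 0 := by
  have hSp : ({0, v} : Set (EuclideanSpace ℝ (Fin 3))).Finite := (finite_singleton v).insert 0
  have hSm : ({0, -v} : Set (EuclideanSpace ℝ (Fin 3))).Finite := (finite_singleton (-v)).insert 0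
  have hp0 := twoPoint_measure_compl w v
  have hm0 := twoPoint_measure_compl w (-v)
  have hB0 : (0 : EuclideanSpace ℝ (Fin 3)) ∈ Metric.closedBall (0 : EuclideanSpace ℝ (Fin 3)) ‖v‖ :=
    Metric.mem_closedBall_self (norm_nonneg v)
  have hBv : v ∈ Metric.closedBall (0 : EuclideanSpace ℝ (Fin 3)) ‖v‖ := by
    rw [Metric.mem_closedBall, dist_zero_right]
  have hBnv : -v ∈ Metric.closedBall (0 : EuclideanSpace ℝ (Fin 3)) ‖v‖ := by
    rw [Metric.mem_closedBall, dist_zero_right, norm_neg]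
  refine Measure.ae_smul_measure (ae_add_measure_iff.2 ⟨?_, ?_⟩) _
  · exact (ae_eq_dirac_of_measure_compl_finite hSp hp0).mono fun ν hν => by
      rw [hν]
      exact twoPoint_measure_compl_eq_zero w hB0 hBv
  · exact (ae_eq_dirac_of_measure_compl_finite hSm hm0).mono fun ν hν => by
      rw [hν]
      exact twoPoint_measure_compl_eq_zero w hB0 hBnv

/-- The root energy of the weighted two-point configuration at unit distance:
`∫ V_LJ ‖y‖ d(w δ_0 + w δ_u) = w (V_LJ 0 + V_LJ 1) = -w/12` for `‖u‖ = 1`. [folklore] -/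
theorem rootEnergy_twoPoint {w : ℝ≥0∞} (hw : w ≠ ∞) {u : EuclideanSpace ℝ (Fin 3)} (hu : ‖u‖ = 1) :
    ∫ y, lennardJones ‖y‖ ∂(w • Measure.dirac (0 : EuclideanSpace ℝ (Fin 3)) + w • Measure.dirac u) =
      -w.toReal / 12 := by
  rw [integral_twoPoint hw, norm_zero, lennardJones_zero, hu, lennardJones_one]
  ring

/-! ### Unit weight: the rooted `1`-hard-core counting measure of `{0, u}` -/

/-- The unit-weight two-point configuration `δ_0 + δ_u` (`u ≠ 0`) is the counting measure of
`{0, u}`. [folklore] -/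
theorem twoPoint_one_eq_count_restrict {u : EuclideanSpace ℝ (Fin 3)} (hu : u ≠ 0) :
    (1 : ℝ≥0∞) • Measure.dirac (0 : EuclideanSpace ℝ (Fin 3)) + (1 : ℝ≥0∞) • Measure.dirac u =
      (Measure.count : Measure (EuclideanSpace ℝ (Fin 3))).restrict {0, u} := by
  have hdisj : Disjoint ({0} : Set (EuclideanSpace ℝ (Fin 3))) {u} :=
    disjoint_singleton.2 (Ne.symm hu)
  rw [one_smul, one_smul, show ({0, u} : Set (EuclideanSpace ℝ (Fin 3))) = {0} ∪ {u} from rfl,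
    Measure.restrict_union hdisj (measurableSet_singleton u), Measure.restrict_singleton,
    Measure.restrict_singleton, Measure.count_singleton, Measure.count_singleton, one_smul, one_smul]

/-- The unit-weight two-point configuration at unit distance is a rooted `1`-hard-core
configuration. [folklore] -/
theorem isRootedHardCore_twoPoint_one {u : EuclideanSpace ℝ (Fin 3)} (hu : ‖u‖ = 1) :
    ∃ S : Set (EuclideanSpace ℝ (Fin 3)), (0 : EuclideanSpace ℝ (Fin 3)) ∈ S ∧
      (∀ x ∈ S, ∀ y ∈ S, x ≠ y → (1 : ℝ) ≤ dist x y) ∧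
      (1 : ℝ≥0∞) • Measure.dirac (0 : EuclideanSpace ℝ (Fin 3)) + (1 : ℝ≥0∞) • Measure.dirac u =
        (Measure.count : Measure (EuclideanSpace ℝ (Fin 3))).restrict S := by
  have hu0 : u ≠ 0 := fun h => by simp [h] at hu
  refine ⟨{0, u}, by simp, ?_, twoPoint_one_eq_count_restrict hu0⟩
  intro x hx y hy hxy
  simp only [mem_insert_iff, mem_singleton_iff] at hx hy
  rcases hx with rfl | rfl <;> rcases hy with rfl | rfl
  · exact absurd rfl hxy
  · rw [dist_comm, dist_zero_right, hu]
  · rw [dist_zero_right, hu]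
  · exact absurd rfl hxy

end Summit.AtomisticToContinuum.Crystallization.Theorems.HolmgrenBoyleLindGroundStatesChargeFLCEquilibrium

end
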